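import Summits.QuantumFields.YangMills.Theorems.BalabanUVNodesN05SubBP2DPerKappaSlotOfZd
import Literature.MathematicalPhysics.QuantumFieldTheory.Balaban1983to89.B8Thm2ZdGF3HP2PerMapGammaPrime

/-!
# BalabanUVNodes ∕ N05 ([Balaban1985RegularSpaces] Lemma 1 p. 79 – Thm 8 p. 101, p. 77 «Ω_j ⊂ T_η», (1.3)–(1.4) p. 77): ROW (8′) OF THE PACKAGE «N05-(β′)-GT» —
# THE (β′-PERIODIC) δ₂-SLOT `B8LeafOfRecordSubBP₂DPer` AND ITS κ-CUT ASSEMBLED ON THE GUARDED ROAD (director-ym №227 (b) «GUARDED REQUIRED»): Theorem 2 ∕ 4 from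
# PERIODICITY-GUARDED SOCKETS via dag-n05-c's T6b ∕ T6a (NO transfer′ from the ℤᵈ slot), the other conjuncts passed — the guarded sibling of dag-n05-d's P4 FILE 1
# `BalabanUVNodesN05SubBP2DPerKappaSlotOfZd` (p645824)

Track A of `YM-PLAN.md` (cell `pub-ymgap`, HUMAN RULING D-0062), node **N05**; seat `pub-ymgap-dag-n05-c` (g17), 2026-08-28; bears on K1⁹ `stmt-QuantumFields-27364`
(`--supports`, count-neutral).  WORK-SPLIT with dag-n05-d (pub-ymgap bus 18:26Z ∕ 18:33Z): (8′)∕(9′) = this seat, (10)′–(13)′ = dag-n05-d's (R2) GUARDED editions on them.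

WHAT (pure bookkeeping, conjunct by conjunct, BY NAME): for a periodic residual layer `lamPer : ResidB8Per θ P`, dag-n05-w1's periodic δ₂-slot `B8LeafOfRecordSubBP₂DPer θ P lamPer`
(`B8LeafRS` over `famB8OfRecordSubBP₂DPer θ β len P j := zdGF3HP₂Per θ.𝔸 θ.L β len j.toZdIdx P`) holds as soon as:
* `t2` ∕ `t4` — dag-n05-c's T6b `thm2Printed_zdGF3HP₂Per_mapJ_γ'` ∕ T6a `thm4Printed_zdGF3HP₂Per_mapJ_γ'` at `ι := IdxB8SubDPer.toZdIdx`, `p := fun _ => P`, MODULO the four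
  Theorem-4-frame sockets `SP5base ∕ SP5 ∕ SH59src ∕ SP5u` in dag-n05-w1's GUARDED texts INDEXED BY THE PERIODIC (1.5)-INDEX (member `a.toZdIdx`, period `P`; abstract
  source data `Φ, Adm a, LanF a` + a zero source `(φ₀, hAdm₀, hLan₀)` — the consumer instantiates them, e.g. Theorem 8's source admissibility at `φ₀ := 0`), the member
  laws discharged from the index's faces BY NAME (`Ω 0 = univ`: `j.1.1.1.1.2`; tower law: `B8IdxB8LawsB.IdxB8SubB.tower_all j.1.1.1`; `Ω_j` periodic: `j.periodic`), and the layer's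
  Theorem-4 constant pinned `lamPer.base.B₁' = 5dL·B₈` (`hB₁'eq`, as dag-n05-d's (9)∕(10) pin `B₁, B₂`);
* `p3` — PROPOSITION 3 AS PRINTED on the periodic family, a hypothesis `hP3` (in tree from the GUARDED Prop-3 socket: dag-n05-w1's
  `B8Prop3PrintedZdGF3P2GammaOfSockPer.prop3_famB8OfRecordSubBP₂DPer_of_sockB9P3H2Per`);
* `l1` — kernel (`lemma1Printed_blockPairNA`); `p5e ∕ p5u ∕ p6 ∕ p7 ∕ t8` — passed (`t8`: dag-n05-c's (9′) `t8P₂DPer_of_guardedSocketsSrc_γ'`; `p5e∕p5u`: the `zdLanPer` pin,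
  lit-balaban IR-N05-P5NS; `p6`: F1; `p7`: the display's free slot).
Then dag-n05-w1's K2 restriction gives the κ-CUT slot `B8LeafOfRecordSubBP₂DPerκ θ P M₁ R lamPer` at EVERY pinned pair `(M₁, R)`.

WHAT IS PROVED (two theorems; no estimate; no new definition):
* ★★★ `b8LeafOfRecordSubBP₂DPer_of_guarded` — guarded sockets + zero source + `hP3` + `hB₁'eq` + `p5e p5u p6 p7Per t8Per` ⊢ the periodic δ₂-slot.
* ★★★ `b8LeafOfRecordSubBP₂DPerκ_of_guarded` — the same ⊢ the κ-cut periodic δ₂-slot at any `(M₁, R)`.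
HONEST FRAMING: bookkeeping only; 0 estimates of Bałaban's proved here; every socket ∕ `hP3` ∕ `p5e p5u p6 p7 t8` is a DISPLAYED hypothesis — the sockets askable at periodic data only
and NOT yet served (lit-balaban IR-N05-P5NS ∕ N06); count-neutral; **N05 NOT discharged** (№227 (b)); K1⁹ NOT claimed; Bałaban AS PRINTED (Thm 8 in its SURVIVING form, GAPS G-B8-13);
one finite 𝕋⁴ programme at fixed ε; nothing continuum ∕ ℝ⁴ ∕ OS ∕ mass-gap ∕ Clay.  No `sorry`, no new definition.  Unit `pub-ymgap-dag-n05-c` (g17).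
[cite: Balaban1985RegularSpaces, Lemma 1 – Thm 8 pp.79–101, (1.3)–(1.5) p.77, p.77 («Ω_j ⊂ T_η»), (1.31) p.82; Balaban1985BackgroundPropagators, (3.40) p.397, Thm 3.3 p.399]
-/

noncomputable section

namespace Summit.QuantumFields.YangMills.BalabanUVNodes.N05SubBP2DPerKappaSlotOfGuarded

open Literature.MathematicalPhysics.QuantumFieldTheory.Balaban1983to89
open Literature.MathematicalPhysics.QuantumFieldTheory.Balaban1983to89.Node00
open Literature.MathematicalPhysics.QuantumFieldTheory.Balaban1983to89.B8LeafModelZd (ZdIdx)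
open Literature.MathematicalPhysics.QuantumFieldTheory.Balaban1983to89.B8LeafModelZd3P2 (zdGF3HP₂ zdGF3P₂)
open Literature.MathematicalPhysics.QuantumFieldTheory.Balaban1983to89.B8LeafModelZdHP2Per (zdGF3HP₂Per)
open Literature.MathematicalPhysics.QuantumFieldTheory.Balaban1983to89.B8TowerBondsPrinted (towerBondsP)
open Literature.MathematicalPhysics.QuantumFieldTheory.Balaban1983to89.B8Thm4ZdGF3HP2PerMapGammaPrime (thm4Printed_zdGF3HP₂Per_mapJ_γ')
open Literature.MathematicalPhysics.QuantumFieldTheory.Balaban1983to89.B8Thm2ZdGF3HP2PerMapGammaPrime (thm2Printed_zdGF3HP₂Per_mapJ_γ')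
open Literature.MathematicalPhysics.QuantumFieldTheory.Balaban1983to89.B8Lemma1NonAbelian (mulCfg blockPairNA lemma1Printed_blockPairNA)
open MatrixLog B7Prop1Explicit B7Prop2Explicit B7Prop1Local B7Eq92Concrete
open B7Prop2Explicit (unitaryUnits)
open B7Prop4GeneralLevels (linCovIter)
open B8Ineq130 (tlo thi)
open B8Ineq132 (InAk covDerivFwd)
open B8Eq119TwistedAxial (Restr129 InAx)
open B8Eq140Level (SideTouches)
open B8Eq138LandauZd (IsLandau138W)
open B8Eq184Proof (gaugeExp cfgExp)
open B8Eq146AExpansion (iEta)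
open B8Eq155JBound (Jcur wsup)
open B8ScaledSupNorm (bondNorm msup)

-- `Site` alone could resolve to the torus sites of `Setup.lean`; re-export the `ℤ^d` sites of `B7Prop1Explicit`.
export B7Prop1Explicit (Site)
open T4TermwiseTorus (IsPeriodic)

variable {θ : Stage3Params} {P : ℕ}

/-! ## §1. The periodic δ₂-slot from GUARDED sockets -/

/-- ★★★ **THE (β′-PERIODIC) δ₂-SLOT ON THE GUARDED ROAD**: for `lamPer : ResidB8Per θ P`, dag-n05-w1's `B8LeafOfRecordSubBP₂DPer θ P lamPer` from the four
Theorem-4-frame sockets in dag-n05-w1's GUARDED texts at the periodic (1.5)-index (abstract source data + zero source), Proposition 3 as printed on the periodic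
family (`hP3`), the layer's pin `lamPer.base.B₁' = 5dL·B₈`, and the conjuncts `p5e p5u p6 p7Per t8Per` — `l1` kernel, `t2 := thm2Printed_zdGF3HP₂Per_mapJ_γ'`,
`t4 := thm4Printed_zdGF3HP₂Per_mapJ_γ'` (member laws from the index's faces), NO transfer′.
[cite: Balaban1985RegularSpaces, Lemma 1 p.79, Thm 2 p.83, Prop. 3 p.87, Thm 4 p.88, Prop. 5 p.94, Prop. 6 p.99, Prop. 7 p.100, Thm 8 p.101 (surviving form), p.77 («Ω_j ⊂ T_η»)] -/
theorem b8LeafOfRecordSubBP₂DPer_of_guarded (lamPer : ResidB8Per θ P) (hD : 2 ≤ θ.D)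
    {cu cP γ' B₈ : ℝ} (hcu : 0 < cu) (hcP : 0 < cP) (hγ' : 0 ≤ γ') (hB₈ : 0 < B₈) (hB₀8 : lamPer.base.inp.B₀ ≤ B₈)
    (hB : 2 ≤ 5 * (θ.D : ℝ) * θ.L * B₈) (hγB : 5 * (θ.D : ℝ) * θ.L * lamPer.base.inp.B₀ + 2 * (γ' * lamPer.base.inp.B₀) ≤ 5 * (θ.D : ℝ) * θ.L * B₈)
    (hC₂ : lamPer.base.C₂ ≤ 2097152 * ((θ.D : ℝ) + 1) ^ 2 * (θ.L : ℝ) ^ 2) (hB₀β : 0 < lamPer.base.B₀β)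
    -- the layer's Theorem-4 constant is `B₁′ = 5dL·B₈` (cf. dag-n05-d's (9)∕(10) pins `hB₁eq ∕ hB₂eq`)
    (hB₁'eq : lamPer.base.B₁' = 5 * (θ.D : ℝ) * θ.L * B₈)
    -- abstract source data of the Theorem-4-frame sockets, indexed by the periodic (1.5)-index
    {Φ : Type*} (Adm : IdxB8SubDPer θ P → Φ → (Site θ.D → Fin θ.D → θ.𝔸ˣ) → ℝ → ℝ → Prop)
    (LanF : IdxB8SubDPer θ P → (Site θ.D → Fin θ.D → θ.𝔸ˣ) → Φ → ℕ → (Site θ.D → Fin θ.D → θ.𝔸ˣ) → Prop)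
    -- THE FOUR THEOREM-4-FRAME SOCKETS, γ′ LETTERS, **PERIODICITY-GUARDED** (dag-n05-w1's T4b guards), at the PERIODIC (1.5)-index (member `a.toZdIdx`, period `P`),
    -- below ONE threshold `cP` — HYPOTHESES (servable in print's shape: lit-balaban IR-N05-P5NS for Prop 5 ∃∕!, N06 for [4] Thm 3.3 with source — NOT yet served)
    (SP5base : ∀ a : IdxB8SubDPer θ P, ∀ α₀ α₁ : ℝ, 0 < α₀ → 0 < α₁ → α₀ + α₁ ≤ cP →
      ∀ U₀ U' : Site θ.D → Fin θ.D → θ.𝔸ˣ, (∀ x κ, U₀ x κ ∈ unitaryUnits θ.𝔸) → (∀ x κ, U' x κ ∈ unitaryUnits θ.𝔸) →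
      IsPeriodic P U₀ → IsPeriodic P U' → ∀ φ : Φ, Adm a φ U₀ α₀ α₁ →
      InAk θ.L a.toZdIdx.k a.toZdIdx.η α₀ a.toZdIdx.Ω U₀ → InAk θ.L a.toZdIdx.k a.toZdIdx.η α₀ a.toZdIdx.Ω (mulCfg U' U₀) → (∀ m, m ≤ a.toZdIdx.k → InAx θ.L m (a.toZdIdx.Λs m) U₀ (mulCfg U' U₀)) →
      (∀ j, j ≤ a.toZdIdx.k → ∀ (z : Site θ.D) (μ : Fin θ.D),
        ((∀ x, InBox (tlo θ.L z j) (thi θ.L z j) x → x ∈ a.toZdIdx.Ω j) ∨ (∀ x, InBox (tlo θ.L (z + e μ) j) (thi θ.L (z + e μ) j) x → x ∈ a.toZdIdx.Ω j)) →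
        ‖(avgIter θ.L (mulCfg U' U₀) j z μ : θ.𝔸) - (avgIter θ.L U₀ j z μ : θ.𝔸)‖ ≤ α₁) →
      (∀ b ∈ {b : Site θ.D × Fin θ.D | SideTouches (a.toZdIdx.Ω 0) b.1 b.2}, ‖((U' b.1 b.2 : θ.𝔸ˣ) : θ.𝔸) - 1‖ ≤ α₁) →
      (∃ (v : Site θ.D → θ.𝔸ˣ) (lam : Site θ.D → θ.𝔸), (∀ x, v x ∈ unitaryUnits θ.𝔸) ∧ (∀ x, x ∉ a.toZdIdx.Ω 0 → v x = 1) ∧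
        (∀ j, j ≤ 1 → ∀ b ∈ {b : Site θ.D × Fin θ.D | SideTouches (a.toZdIdx.Ω j) b.1 b.2}, (v b.1 : θ.𝔸) = ((gaugeExp lam b.1 : θ.𝔸ˣ) : θ.𝔸) ∧
        (v (b.1 + e b.2) : θ.𝔸) = ((gaugeExp lam (b.1 + e b.2) : θ.𝔸ˣ) : θ.𝔸)) ∧
        (∀ j, j ≤ 1 → ∀ b ∈ {b : Site θ.D × Fin θ.D | SideTouches (a.toZdIdx.Ω j) b.1 b.2},
        ‖lam b.1‖ ≤ (8 * lamPer.base.inp.B₀' * (5 * (θ.D : ℝ) * θ.L * B₈) * (α₀ + α₁)) ∧ ((θ.L : ℝ) ^ j * a.toZdIdx.η) * ‖covDerivFwd a.toZdIdx.η U₀ b.2 lam b.1‖ ≤ (8 * lamPer.base.inp.B₀' * (5 * (θ.D : ℝ) * θ.L * B₈) * (α₀ + α₁))) ∧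
        LanF a U₀ φ 1 (mgauge U₀ v⁻¹ U') ∧ Restr129 θ.L 1 (a.toZdIdx.Λs 1) U₀ ((1 : Site θ.D → θ.𝔸ˣ) * v) ∧ IsPeriodic P v))
    (SP5 : ∀ a : IdxB8SubDPer θ P, ∀ α₀ α₁ : ℝ, 0 < α₀ → 0 < α₁ → α₀ + α₁ ≤ cP →
      ∀ U₀ U' : Site θ.D → Fin θ.D → θ.𝔸ˣ, (∀ x κ, U₀ x κ ∈ unitaryUnits θ.𝔸) → (∀ x κ, U' x κ ∈ unitaryUnits θ.𝔸) →
      IsPeriodic P U₀ → IsPeriodic P U' → ∀ φ : Φ, Adm a φ U₀ α₀ α₁ →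
      InAk θ.L a.toZdIdx.k a.toZdIdx.η α₀ a.toZdIdx.Ω U₀ → InAk θ.L a.toZdIdx.k a.toZdIdx.η α₀ a.toZdIdx.Ω (mulCfg U' U₀) → (∀ m, m ≤ a.toZdIdx.k → InAx θ.L m (a.toZdIdx.Λs m) U₀ (mulCfg U' U₀)) →
      (∀ j, j ≤ a.toZdIdx.k → ∀ (z : Site θ.D) (μ : Fin θ.D),
        ((∀ x, InBox (tlo θ.L z j) (thi θ.L z j) x → x ∈ a.toZdIdx.Ω j) ∨ (∀ x, InBox (tlo θ.L (z + e μ) j) (thi θ.L (z + e μ) j) x → x ∈ a.toZdIdx.Ω j)) →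
        ‖(avgIter θ.L (mulCfg U' U₀) j z μ : θ.𝔸) - (avgIter θ.L U₀ j z μ : θ.𝔸)‖ ≤ α₁) →
      (∀ b ∈ {b : Site θ.D × Fin θ.D | SideTouches (a.toZdIdx.Ω 0) b.1 b.2}, ‖((U' b.1 b.2 : θ.𝔸ˣ) : θ.𝔸) - 1‖ ≤ α₁) →
      (∀ m, 1 ≤ m → m < a.toZdIdx.k → ∀ (u₁ : Site θ.D → θ.𝔸ˣ) (U₁ : Site θ.D → Fin θ.D → θ.𝔸ˣ) (A : Site θ.D → Fin θ.D → θ.𝔸),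
        (∀ x, u₁ x ∈ unitaryUnits θ.𝔸) → (∀ x, x ∉ a.toZdIdx.Ω 0 → u₁ x = 1) → IsPeriodic P u₁ → IsPeriodic P U₁ → IsPeriodic P A →
        mgauge U₀ u₁ U₁ = U' → Restr129 θ.L m (a.toZdIdx.Λs m) U₀ u₁ → LanF a U₀ φ m U₁ →
        (∀ j, j ≤ m → ∀ b ∈ {b : Site θ.D × Fin θ.D | SideTouches (a.toZdIdx.Ω j) b.1 b.2},
        U₁ b.1 b.2 = cfgExp a.toZdIdx.η A b.1 b.2 ∧ IsSelfAdjoint (A b.1 b.2) ∧ ‖A b.1 b.2‖ ≤ (5 * (θ.D : ℝ) * θ.L * B₈ * (α₀ + α₁)) * ((θ.L : ℝ) ^ j * a.toZdIdx.η)⁻¹) →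
        ∃ (v : Site θ.D → θ.𝔸ˣ) (lam : Site θ.D → θ.𝔸), (∀ x, v x ∈ unitaryUnits θ.𝔸) ∧ (∀ x, x ∉ a.toZdIdx.Ω 0 → v x = 1) ∧
        (∀ j, j ≤ m + 1 → ∀ b ∈ {b : Site θ.D × Fin θ.D | SideTouches (a.toZdIdx.Ω j) b.1 b.2}, (v b.1 : θ.𝔸) = ((gaugeExp lam b.1 : θ.𝔸ˣ) : θ.𝔸) ∧
        (v (b.1 + e b.2) : θ.𝔸) = ((gaugeExp lam (b.1 + e b.2) : θ.𝔸ˣ) : θ.𝔸)) ∧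
        (∀ j, j ≤ m + 1 → ∀ b ∈ {b : Site θ.D × Fin θ.D | SideTouches (a.toZdIdx.Ω j) b.1 b.2},
        ‖lam b.1‖ ≤ (8 * lamPer.base.inp.B₀' * (5 * (θ.D : ℝ) * θ.L * B₈) * (α₀ + α₁)) ∧ ((θ.L : ℝ) ^ j * a.toZdIdx.η) * ‖covDerivFwd a.toZdIdx.η U₀ b.2 lam b.1‖ ≤ (8 * lamPer.base.inp.B₀' * (5 * (θ.D : ℝ) * θ.L * B₈) * (α₀ + α₁))) ∧
        LanF a U₀ φ (m + 1) (mgauge U₀ v⁻¹ U₁) ∧ Restr129 θ.L (m + 1) (a.toZdIdx.Λs (m + 1)) U₀ (u₁ * v) ∧ IsPeriodic P v))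
    (SH59src : ∀ a : IdxB8SubDPer θ P, ∀ α₀ α₁ : ℝ, 0 < α₀ → 0 < α₁ → α₀ + α₁ ≤ cP →
      ∀ U₀ U' : Site θ.D → Fin θ.D → θ.𝔸ˣ, (∀ x κ, U₀ x κ ∈ unitaryUnits θ.𝔸) → (∀ x κ, U' x κ ∈ unitaryUnits θ.𝔸) →
      IsPeriodic P U₀ → IsPeriodic P U' → ∀ φ : Φ, Adm a φ U₀ α₀ α₁ →
      InAk θ.L a.toZdIdx.k a.toZdIdx.η α₀ a.toZdIdx.Ω U₀ → InAk θ.L a.toZdIdx.k a.toZdIdx.η α₀ a.toZdIdx.Ω (mulCfg U' U₀) → (∀ m, m ≤ a.toZdIdx.k → InAx θ.L m (a.toZdIdx.Λs m) U₀ (mulCfg U' U₀)) →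
      (∀ j, j ≤ a.toZdIdx.k → ∀ (z : Site θ.D) (μ : Fin θ.D),
        ((∀ x, InBox (tlo θ.L z j) (thi θ.L z j) x → x ∈ a.toZdIdx.Ω j) ∨ (∀ x, InBox (tlo θ.L (z + e μ) j) (thi θ.L (z + e μ) j) x → x ∈ a.toZdIdx.Ω j)) →
        ‖(avgIter θ.L (mulCfg U' U₀) j z μ : θ.𝔸) - (avgIter θ.L U₀ j z μ : θ.𝔸)‖ ≤ α₁) →
      (∀ b ∈ {b : Site θ.D × Fin θ.D | SideTouches (a.toZdIdx.Ω 0) b.1 b.2}, ‖((U' b.1 b.2 : θ.𝔸ˣ) : θ.𝔸) - 1‖ ≤ α₁) →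
      (∀ m, 1 ≤ m → m ≤ a.toZdIdx.k → ∀ (u : Site θ.D → θ.𝔸ˣ) (W : Site θ.D → Fin θ.D → θ.𝔸ˣ) (A' : Site θ.D → Fin θ.D → θ.𝔸),
        (∀ x, u x ∈ unitaryUnits θ.𝔸) → IsPeriodic P u → IsPeriodic P W → IsPeriodic P A' →
        mgauge U₀ u W = U' → Restr129 θ.L m (a.toZdIdx.Λs m) U₀ u → LanF a U₀ φ m W →
        (∀ y τ, IsSelfAdjoint (A' y τ)) →
        (∀ j, j ≤ m → ∀ y τ, SideTouches (a.toZdIdx.Ω j) y τ →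
        W y τ = cfgExp a.toZdIdx.η A' y τ ∧ ‖A' y τ‖ ≤ (2 * (θ.L * (5 * (θ.D : ℝ) * θ.L * B₈ * (α₀ + α₁))) + 8 * (8 * lamPer.base.inp.B₀' * (5 * (θ.D : ℝ) * θ.L * B₈) * (α₀ + α₁))) * ((θ.L : ℝ) ^ j * a.toZdIdx.η)⁻¹) →
        (∀ y τ, (∀ j, j ≤ m → ¬ SideTouches (a.toZdIdx.Ω j) y τ) → A' y τ = 0) →
        msup θ.L m a.toZdIdx.η (-(1 : ℝ)) (fun j (b : Site θ.D × Fin θ.D) => SideTouches (a.toZdIdx.Ω j) b.1 b.2) (fun b => A' b.1 b.2)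
        ≤ lamPer.base.inp.B₀ * (bondNorm θ.L m a.toZdIdx.η (-(3 : ℝ)) a.toZdIdx.Ω (fun x μ => Jcur a.toZdIdx.η U₀ A' μ x)
        + wsup 1 (fun p : {p : ℕ × (Site θ.D × Fin θ.D) // p.1 ≤ m ∧ p.2 ∈ towerBondsP θ.L a.toZdIdx.Ω (a.toZdIdx.Λs m) p.1} =>
        linCovIter θ.L U₀ (iEta a.toZdIdx.η A') p.1.1 p.1.2.1 p.1.2.2)) + γ' * lamPer.base.inp.B₀ * (α₀ + α₁) ∧
        msup θ.L m a.toZdIdx.η (-(2 : ℝ)) (fun j (t : Fin θ.D × Fin θ.D × Site θ.D) => SideTouches (a.toZdIdx.Ω j) t.2.2 t.2.1)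
        (fun t => covDerivFwd a.toZdIdx.η U₀ t.1 (fun z => A' z t.2.1) t.2.2)
        ≤ lamPer.base.inp.B₀ * (bondNorm θ.L m a.toZdIdx.η (-(3 : ℝ)) a.toZdIdx.Ω (fun x μ => Jcur a.toZdIdx.η U₀ A' μ x)
        + wsup 1 (fun p : {p : ℕ × (Site θ.D × Fin θ.D) // p.1 ≤ m ∧ p.2 ∈ towerBondsP θ.L a.toZdIdx.Ω (a.toZdIdx.Λs m) p.1} =>
        linCovIter θ.L U₀ (iEta a.toZdIdx.η A') p.1.1 p.1.2.1 p.1.2.2)) + γ' * lamPer.base.inp.B₀ * (α₀ + α₁)))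
    (SP5u : ∀ a : IdxB8SubDPer θ P, ∀ α₀ α₁ : ℝ, 0 < α₀ → 0 < α₁ → α₀ + α₁ ≤ cP →
      ∀ U₀ U' : Site θ.D → Fin θ.D → θ.𝔸ˣ, (∀ x κ, U₀ x κ ∈ unitaryUnits θ.𝔸) → (∀ x κ, U' x κ ∈ unitaryUnits θ.𝔸) →
      IsPeriodic P U₀ → IsPeriodic P U' → ∀ φ : Φ, Adm a φ U₀ α₀ α₁ →
      InAk θ.L a.toZdIdx.k a.toZdIdx.η α₀ a.toZdIdx.Ω U₀ → InAk θ.L a.toZdIdx.k a.toZdIdx.η α₀ a.toZdIdx.Ω (mulCfg U' U₀) → (∀ m, m ≤ a.toZdIdx.k → InAx θ.L m (a.toZdIdx.Λs m) U₀ (mulCfg U' U₀)) →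
      (∀ j, j ≤ a.toZdIdx.k → ∀ (z : Site θ.D) (μ : Fin θ.D),
        ((∀ x, InBox (tlo θ.L z j) (thi θ.L z j) x → x ∈ a.toZdIdx.Ω j) ∨ (∀ x, InBox (tlo θ.L (z + e μ) j) (thi θ.L (z + e μ) j) x → x ∈ a.toZdIdx.Ω j)) →
        ‖(avgIter θ.L (mulCfg U' U₀) j z μ : θ.𝔸) - (avgIter θ.L U₀ j z μ : θ.𝔸)‖ ≤ α₁) →
      (∀ b ∈ {b : Site θ.D × Fin θ.D | SideTouches (a.toZdIdx.Ω 0) b.1 b.2}, ‖((U' b.1 b.2 : θ.𝔸ˣ) : θ.𝔸) - 1‖ ≤ α₁) →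
      ∀ u₁ : Site θ.D → θ.𝔸ˣ, (∀ x, u₁ x ∈ unitaryUnits θ.𝔸) → (∀ x, x ∉ a.toZdIdx.Ω 0 → u₁ x = 1) → IsPeriodic P u₁ → Restr129 θ.L a.toZdIdx.k (a.toZdIdx.Λs a.toZdIdx.k) U₀ u₁ →
      LanF a U₀ φ a.toZdIdx.k (mgauge U₀ u₁⁻¹ U') →
      (∃ A₁ : Site θ.D → Fin θ.D → θ.𝔸, ∀ j, j ≤ a.toZdIdx.k → ∀ (x : Site θ.D) (κ : Fin θ.D), SideTouches (a.toZdIdx.Ω j) x κ →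
        mgauge U₀ u₁⁻¹ U' x κ = cfgExp a.toZdIdx.η A₁ x κ ∧ ‖A₁ x κ‖ ≤ (5 * (θ.D : ℝ) * θ.L * B₈ * (α₀ + α₁)) * ((θ.L : ℝ) ^ j * a.toZdIdx.η)⁻¹) →
      ∀ (v w : Site θ.D → θ.𝔸ˣ) (lam mu : Site θ.D → θ.𝔸),
      IsPeriodic P v → IsPeriodic P w → IsPeriodic P lam → IsPeriodic P mu →
      (∀ x, ((gaugeExp lam x : θ.𝔸ˣ) : θ.𝔸) = ((v x : θ.𝔸ˣ) : θ.𝔸) ∧ IsSelfAdjoint (lam x) ∧ ‖lam x‖ < cu) → (∀ x, x ∉ a.toZdIdx.Ω 0 → lam x = 0) →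
      (∀ j, j ≤ a.toZdIdx.k → ∀ b ∈ {b : Site θ.D × Fin θ.D | SideTouches (a.toZdIdx.Ω j) b.1 b.2}, ((θ.L : ℝ) ^ j * a.toZdIdx.η) * ‖covDerivFwd a.toZdIdx.η U₀ b.2 lam b.1‖ < cu) →
      (∀ x, ((gaugeExp mu x : θ.𝔸ˣ) : θ.𝔸) = ((w x : θ.𝔸ˣ) : θ.𝔸) ∧ IsSelfAdjoint (mu x) ∧ ‖mu x‖ < cu) → (∀ x, x ∉ a.toZdIdx.Ω 0 → mu x = 0) →
      (∀ j, j ≤ a.toZdIdx.k → ∀ b ∈ {b : Site θ.D × Fin θ.D | SideTouches (a.toZdIdx.Ω j) b.1 b.2}, ((θ.L : ℝ) ^ j * a.toZdIdx.η) * ‖covDerivFwd a.toZdIdx.η U₀ b.2 mu b.1‖ < cu) →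
      LanF a U₀ φ a.toZdIdx.k (mgauge U₀ v⁻¹ (mgauge U₀ u₁⁻¹ U')) → Restr129 θ.L a.toZdIdx.k (a.toZdIdx.Λs a.toZdIdx.k) U₀ (u₁ * v) →
      LanF a U₀ φ a.toZdIdx.k (mgauge U₀ w⁻¹ (mgauge U₀ u₁⁻¹ U')) → Restr129 θ.L a.toZdIdx.k (a.toZdIdx.Λs a.toZdIdx.k) U₀ (u₁ * w) →
      ∀ x, v x = w x)
    -- the ZERO SOURCE (admitted everywhere; its level-`k` gauge condition = the carrier's (1.38) `Landau`)
    (φ₀ : Φ) (hAdm₀ : ∀ a : IdxB8SubDPer θ P, ∀ α₀ α₁ : ℝ, 0 < α₀ → 0 < α₁ → ∀ U₀ : Site θ.D → Fin θ.D → θ.𝔸ˣ, (∀ x κ, U₀ x κ ∈ unitaryUnits θ.𝔸) →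
      Adm a φ₀ U₀ α₀ α₁)
    (hLan₀ : ∀ a : IdxB8SubDPer θ P, ∀ U₀ W : Site θ.D → Fin θ.D → θ.𝔸ˣ,
      LanF a U₀ φ₀ a.toZdIdx.k W ↔ IsLandau138W θ.L a.toZdIdx.k a.toZdIdx.η (a.toZdIdx.Ω 0) (a.toZdIdx.Λs a.toZdIdx.k) U₀ W)
    -- PROPOSITION 3 AS PRINTED on the periodic family (in tree from the GUARDED Prop-3 socket)
    (hP3 : B8.Prop3Printed θ.D (θ.L : ℝ) lamPer.base.C₂ lamPer.base.inp lamPer.base.B₀β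
      (fun j : IdxB8SubDPer θ P => (famB8OfRecordSubBP₂DPer θ lamPer.base.β lamPer.base.len P j).toGFData2))
    -- the remaining conjuncts, passed
    (p5e : B8.Prop5Exists lamPer.base.inp.B₀' lamPer.base.B₁ lamPer.base.lan) (p5u : B8.Prop5Unique lamPer.base.lan)
    (p6 : B8.Prop6Printed θ.D (θ.L : ℝ) lamPer.base.B₁ lamPer.base.c₁ lamPer.base.cub)
    (p7Per : B8SectGH.Prop7PrintedR (famB8OfRecordSubBP₂DPer θ lamPer.base.β lamPer.base.len P) lamPer.toAxial)
    (t8Per : B8Thm8Surviving.Thm8SurvivingAt 1 lamPer.base.B₁ lamPer.base.B₂ (famB8OfRecordSubBP₂DPer θ lamPer.base.β lamPer.base.len P)) :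
    B8LeafOfRecordSubBP₂DPer θ P lamPer where
  l1 := lemma1Printed_blockPairNA θ.D θ.L θ.𝔸
  t2 := thm2Printed_zdGF3HP₂Per_mapJ_γ' (𝔸 := θ.𝔸) (β := lamPer.base.β) (len := lamPer.base.len) hD θ.two_le_L lamPer.base.inp hB₀β hcu hcP hC₂ hγ' hB₈ hB₀8 hB hγB
    (fun j : IdxB8SubDPer θ P => j.toZdIdx) (fun _ => P) Adm LanF SP5base SP5 SH59src SP5u φ₀ hAdm₀ hLan₀
    (fun j => j.1.1.1.1.2) (fun j l _ => j.periodic l) (fun j => B8IdxB8LawsB.IdxB8SubB.tower_all j.1.1.1) hP3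
  p3 := hP3
  t4 := by
    rw [show (fun i : IdxB8SubDPer θ P => (famB8OfRecordSubBP₂DPer θ lamPer.base.β lamPer.base.len P i).toGFData) =
        (fun a : IdxB8SubDPer θ P => (zdGF3HP₂Per θ.𝔸 θ.L lamPer.base.β lamPer.base.len a.toZdIdx P).toGFData) from rfl, hB₁'eq]
    exact thm4Printed_zdGF3HP₂Per_mapJ_γ' (𝔸 := θ.𝔸) (β := lamPer.base.β) (len := lamPer.base.len) hD θ.two_le_L lamPer.base.inp.B₀_pos lamPer.base.inp.B₀'_pos hcu hcP
      hγ' hB₈ hB₀8 hB hγB (fun j : IdxB8SubDPer θ P => j.toZdIdx) (fun _ => P) Adm LanF SP5base SP5 SH59src SP5u φ₀ hAdm₀ hLan₀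
      (fun j => B8IdxB8LawsB.IdxB8SubB.tower_all j.1.1.1) (fun j l _ => j.periodic l)
  p5e := p5e
  p5u := p5u
  p6 := p6
  p7 := p7Per
  t8 := t8Per

/-! ## §2. … and its κ-cut -/

/-- ★★★ **… AND TO ITS κ-CUT AT EVERY PINNED PAIR `(M₁, R)`** (dag-n05-w1's K2 restriction `b8LeafOfRecordSubBP₂DPerκ_of_subBP₂DPer`): print's (1.3)–(1.4) class at block
size `M₁`, ON THE GUARDED ROAD. [cite: Balaban1985RegularSpaces, (1.3)–(1.4) p.77, Lemma 1 – Thm 8 pp.79–101 (bookkeeping: restriction of the family index)] -/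
theorem b8LeafOfRecordSubBP₂DPerκ_of_guarded (M₁ R : ℕ) (lamPer : ResidB8Per θ P) (hD : 2 ≤ θ.D)
    {cu cP γ' B₈ : ℝ} (hcu : 0 < cu) (hcP : 0 < cP) (hγ' : 0 ≤ γ') (hB₈ : 0 < B₈) (hB₀8 : lamPer.base.inp.B₀ ≤ B₈)
    (hB : 2 ≤ 5 * (θ.D : ℝ) * θ.L * B₈) (hγB : 5 * (θ.D : ℝ) * θ.L * lamPer.base.inp.B₀ + 2 * (γ' * lamPer.base.inp.B₀) ≤ 5 * (θ.D : ℝ) * θ.L * B₈)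
    (hC₂ : lamPer.base.C₂ ≤ 2097152 * ((θ.D : ℝ) + 1) ^ 2 * (θ.L : ℝ) ^ 2) (hB₀β : 0 < lamPer.base.B₀β)
    (hB₁'eq : lamPer.base.B₁' = 5 * (θ.D : ℝ) * θ.L * B₈)
    {Φ : Type*} (Adm : IdxB8SubDPer θ P → Φ → (Site θ.D → Fin θ.D → θ.𝔸ˣ) → ℝ → ℝ → Prop)
    (LanF : IdxB8SubDPer θ P → (Site θ.D → Fin θ.D → θ.𝔸ˣ) → Φ → ℕ → (Site θ.D → Fin θ.D → θ.𝔸ˣ) → Prop)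
    (SP5base : ∀ a : IdxB8SubDPer θ P, ∀ α₀ α₁ : ℝ, 0 < α₀ → 0 < α₁ → α₀ + α₁ ≤ cP →
      ∀ U₀ U' : Site θ.D → Fin θ.D → θ.𝔸ˣ, (∀ x κ, U₀ x κ ∈ unitaryUnits θ.𝔸) → (∀ x κ, U' x κ ∈ unitaryUnits θ.𝔸) →
      IsPeriodic P U₀ → IsPeriodic P U' → ∀ φ : Φ, Adm a φ U₀ α₀ α₁ →
      InAk θ.L a.toZdIdx.k a.toZdIdx.η α₀ a.toZdIdx.Ω U₀ → InAk θ.L a.toZdIdx.k a.toZdIdx.η α₀ a.toZdIdx.Ω (mulCfg U' U₀) → (∀ m, m ≤ a.toZdIdx.k → InAx θ.L m (a.toZdIdx.Λs m) U₀ (mulCfg U' U₀)) →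
      (∀ j, j ≤ a.toZdIdx.k → ∀ (z : Site θ.D) (μ : Fin θ.D),
        ((∀ x, InBox (tlo θ.L z j) (thi θ.L z j) x → x ∈ a.toZdIdx.Ω j) ∨ (∀ x, InBox (tlo θ.L (z + e μ) j) (thi θ.L (z + e μ) j) x → x ∈ a.toZdIdx.Ω j)) →
        ‖(avgIter θ.L (mulCfg U' U₀) j z μ : θ.𝔸) - (avgIter θ.L U₀ j z μ : θ.𝔸)‖ ≤ α₁) →
      (∀ b ∈ {b : Site θ.D × Fin θ.D | SideTouches (a.toZdIdx.Ω 0) b.1 b.2}, ‖((U' b.1 b.2 : θ.𝔸ˣ) : θ.𝔸) - 1‖ ≤ α₁) →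
      (∃ (v : Site θ.D → θ.𝔸ˣ) (lam : Site θ.D → θ.𝔸), (∀ x, v x ∈ unitaryUnits θ.𝔸) ∧ (∀ x, x ∉ a.toZdIdx.Ω 0 → v x = 1) ∧
        (∀ j, j ≤ 1 → ∀ b ∈ {b : Site θ.D × Fin θ.D | SideTouches (a.toZdIdx.Ω j) b.1 b.2}, (v b.1 : θ.𝔸) = ((gaugeExp lam b.1 : θ.𝔸ˣ) : θ.𝔸) ∧
        (v (b.1 + e b.2) : θ.𝔸) = ((gaugeExp lam (b.1 + e b.2) : θ.𝔸ˣ) : θ.𝔸)) ∧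
        (∀ j, j ≤ 1 → ∀ b ∈ {b : Site θ.D × Fin θ.D | SideTouches (a.toZdIdx.Ω j) b.1 b.2},
        ‖lam b.1‖ ≤ (8 * lamPer.base.inp.B₀' * (5 * (θ.D : ℝ) * θ.L * B₈) * (α₀ + α₁)) ∧ ((θ.L : ℝ) ^ j * a.toZdIdx.η) * ‖covDerivFwd a.toZdIdx.η U₀ b.2 lam b.1‖ ≤ (8 * lamPer.base.inp.B₀' * (5 * (θ.D : ℝ) * θ.L * B₈) * (α₀ + α₁))) ∧
        LanF a U₀ φ 1 (mgauge U₀ v⁻¹ U') ∧ Restr129 θ.L 1 (a.toZdIdx.Λs 1) U₀ ((1 : Site θ.D → θ.𝔸ˣ) * v) ∧ IsPeriodic P v))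
    (SP5 : ∀ a : IdxB8SubDPer θ P, ∀ α₀ α₁ : ℝ, 0 < α₀ → 0 < α₁ → α₀ + α₁ ≤ cP →
      ∀ U₀ U' : Site θ.D → Fin θ.D → θ.𝔸ˣ, (∀ x κ, U₀ x κ ∈ unitaryUnits θ.𝔸) → (∀ x κ, U' x κ ∈ unitaryUnits θ.𝔸) →
      IsPeriodic P U₀ → IsPeriodic P U' → ∀ φ : Φ, Adm a φ U₀ α₀ α₁ →
      InAk θ.L a.toZdIdx.k a.toZdIdx.η α₀ a.toZdIdx.Ω U₀ → InAk θ.L a.toZdIdx.k a.toZdIdx.η α₀ a.toZdIdx.Ω (mulCfg U' U₀) → (∀ m, m ≤ a.toZdIdx.k → InAx θ.L m (a.toZdIdx.Λs m) U₀ (mulCfg U' U₀)) →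
      (∀ j, j ≤ a.toZdIdx.k → ∀ (z : Site θ.D) (μ : Fin θ.D),
        ((∀ x, InBox (tlo θ.L z j) (thi θ.L z j) x → x ∈ a.toZdIdx.Ω j) ∨ (∀ x, InBox (tlo θ.L (z + e μ) j) (thi θ.L (z + e μ) j) x → x ∈ a.toZdIdx.Ω j)) →
        ‖(avgIter θ.L (mulCfg U' U₀) j z μ : θ.𝔸) - (avgIter θ.L U₀ j z μ : θ.𝔸)‖ ≤ α₁) →
      (∀ b ∈ {b : Site θ.D × Fin θ.D | SideTouches (a.toZdIdx.Ω 0) b.1 b.2}, ‖((U' b.1 b.2 : θ.𝔸ˣ) : θ.𝔸) - 1‖ ≤ α₁) →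
      (∀ m, 1 ≤ m → m < a.toZdIdx.k → ∀ (u₁ : Site θ.D → θ.𝔸ˣ) (U₁ : Site θ.D → Fin θ.D → θ.𝔸ˣ) (A : Site θ.D → Fin θ.D → θ.𝔸),
        (∀ x, u₁ x ∈ unitaryUnits θ.𝔸) → (∀ x, x ∉ a.toZdIdx.Ω 0 → u₁ x = 1) → IsPeriodic P u₁ → IsPeriodic P U₁ → IsPeriodic P A →
        mgauge U₀ u₁ U₁ = U' → Restr129 θ.L m (a.toZdIdx.Λs m) U₀ u₁ → LanF a U₀ φ m U₁ →
        (∀ j, j ≤ m → ∀ b ∈ {b : Site θ.D × Fin θ.D | SideTouches (a.toZdIdx.Ω j) b.1 b.2},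
        U₁ b.1 b.2 = cfgExp a.toZdIdx.η A b.1 b.2 ∧ IsSelfAdjoint (A b.1 b.2) ∧ ‖A b.1 b.2‖ ≤ (5 * (θ.D : ℝ) * θ.L * B₈ * (α₀ + α₁)) * ((θ.L : ℝ) ^ j * a.toZdIdx.η)⁻¹) →
        ∃ (v : Site θ.D → θ.𝔸ˣ) (lam : Site θ.D → θ.𝔸), (∀ x, v x ∈ unitaryUnits θ.𝔸) ∧ (∀ x, x ∉ a.toZdIdx.Ω 0 → v x = 1) ∧
        (∀ j, j ≤ m + 1 → ∀ b ∈ {b : Site θ.D × Fin θ.D | SideTouches (a.toZdIdx.Ω j) b.1 b.2}, (v b.1 : θ.𝔸) = ((gaugeExp lam b.1 : θ.𝔸ˣ) : θ.𝔸) ∧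
        (v (b.1 + e b.2) : θ.𝔸) = ((gaugeExp lam (b.1 + e b.2) : θ.𝔸ˣ) : θ.𝔸)) ∧
        (∀ j, j ≤ m + 1 → ∀ b ∈ {b : Site θ.D × Fin θ.D | SideTouches (a.toZdIdx.Ω j) b.1 b.2},
        ‖lam b.1‖ ≤ (8 * lamPer.base.inp.B₀' * (5 * (θ.D : ℝ) * θ.L * B₈) * (α₀ + α₁)) ∧ ((θ.L : ℝ) ^ j * a.toZdIdx.η) * ‖covDerivFwd a.toZdIdx.η U₀ b.2 lam b.1‖ ≤ (8 * lamPer.base.inp.B₀' * (5 * (θ.D : ℝ) * θ.L * B₈) * (α₀ + α₁))) ∧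
        LanF a U₀ φ (m + 1) (mgauge U₀ v⁻¹ U₁) ∧ Restr129 θ.L (m + 1) (a.toZdIdx.Λs (m + 1)) U₀ (u₁ * v) ∧ IsPeriodic P v))
    (SH59src : ∀ a : IdxB8SubDPer θ P, ∀ α₀ α₁ : ℝ, 0 < α₀ → 0 < α₁ → α₀ + α₁ ≤ cP →
      ∀ U₀ U' : Site θ.D → Fin θ.D → θ.𝔸ˣ, (∀ x κ, U₀ x κ ∈ unitaryUnits θ.𝔸) → (∀ x κ, U' x κ ∈ unitaryUnits θ.𝔸) →
      IsPeriodic P U₀ → IsPeriodic P U' → ∀ φ : Φ, Adm a φ U₀ α₀ α₁ →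
      InAk θ.L a.toZdIdx.k a.toZdIdx.η α₀ a.toZdIdx.Ω U₀ → InAk θ.L a.toZdIdx.k a.toZdIdx.η α₀ a.toZdIdx.Ω (mulCfg U' U₀) → (∀ m, m ≤ a.toZdIdx.k → InAx θ.L m (a.toZdIdx.Λs m) U₀ (mulCfg U' U₀)) →
      (∀ j, j ≤ a.toZdIdx.k → ∀ (z : Site θ.D) (μ : Fin θ.D),
        ((∀ x, InBox (tlo θ.L z j) (thi θ.L z j) x → x ∈ a.toZdIdx.Ω j) ∨ (∀ x, InBox (tlo θ.L (z + e μ) j) (thi θ.L (z + e μ) j) x → x ∈ a.toZdIdx.Ω j)) →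
        ‖(avgIter θ.L (mulCfg U' U₀) j z μ : θ.𝔸) - (avgIter θ.L U₀ j z μ : θ.𝔸)‖ ≤ α₁) →
      (∀ b ∈ {b : Site θ.D × Fin θ.D | SideTouches (a.toZdIdx.Ω 0) b.1 b.2}, ‖((U' b.1 b.2 : θ.𝔸ˣ) : θ.𝔸) - 1‖ ≤ α₁) →
      (∀ m, 1 ≤ m → m ≤ a.toZdIdx.k → ∀ (u : Site θ.D → θ.𝔸ˣ) (W : Site θ.D → Fin θ.D → θ.𝔸ˣ) (A' : Site θ.D → Fin θ.D → θ.𝔸),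
        (∀ x, u x ∈ unitaryUnits θ.𝔸) → IsPeriodic P u → IsPeriodic P W → IsPeriodic P A' →
        mgauge U₀ u W = U' → Restr129 θ.L m (a.toZdIdx.Λs m) U₀ u → LanF a U₀ φ m W →
        (∀ y τ, IsSelfAdjoint (A' y τ)) →
        (∀ j, j ≤ m → ∀ y τ, SideTouches (a.toZdIdx.Ω j) y τ →
        W y τ = cfgExp a.toZdIdx.η A' y τ ∧ ‖A' y τ‖ ≤ (2 * (θ.L * (5 * (θ.D : ℝ) * θ.L * B₈ * (α₀ + α₁))) + 8 * (8 * lamPer.base.inp.B₀' * (5 * (θ.D : ℝ) * θ.L * B₈) * (α₀ + α₁))) * ((θ.L : ℝ) ^ j * a.toZdIdx.η)⁻¹) →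
        (∀ y τ, (∀ j, j ≤ m → ¬ SideTouches (a.toZdIdx.Ω j) y τ) → A' y τ = 0) →
        msup θ.L m a.toZdIdx.η (-(1 : ℝ)) (fun j (b : Site θ.D × Fin θ.D) => SideTouches (a.toZdIdx.Ω j) b.1 b.2) (fun b => A' b.1 b.2)
        ≤ lamPer.base.inp.B₀ * (bondNorm θ.L m a.toZdIdx.η (-(3 : ℝ)) a.toZdIdx.Ω (fun x μ => Jcur a.toZdIdx.η U₀ A' μ x)
        + wsup 1 (fun p : {p : ℕ × (Site θ.D × Fin θ.D) // p.1 ≤ m ∧ p.2 ∈ towerBondsP θ.L a.toZdIdx.Ω (a.toZdIdx.Λs m) p.1} =>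
        linCovIter θ.L U₀ (iEta a.toZdIdx.η A') p.1.1 p.1.2.1 p.1.2.2)) + γ' * lamPer.base.inp.B₀ * (α₀ + α₁) ∧
        msup θ.L m a.toZdIdx.η (-(2 : ℝ)) (fun j (t : Fin θ.D × Fin θ.D × Site θ.D) => SideTouches (a.toZdIdx.Ω j) t.2.2 t.2.1)
        (fun t => covDerivFwd a.toZdIdx.η U₀ t.1 (fun z => A' z t.2.1) t.2.2)
        ≤ lamPer.base.inp.B₀ * (bondNorm θ.L m a.toZdIdx.η (-(3 : ℝ)) a.toZdIdx.Ω (fun x μ => Jcur a.toZdIdx.η U₀ A' μ x)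
        + wsup 1 (fun p : {p : ℕ × (Site θ.D × Fin θ.D) // p.1 ≤ m ∧ p.2 ∈ towerBondsP θ.L a.toZdIdx.Ω (a.toZdIdx.Λs m) p.1} =>
        linCovIter θ.L U₀ (iEta a.toZdIdx.η A') p.1.1 p.1.2.1 p.1.2.2)) + γ' * lamPer.base.inp.B₀ * (α₀ + α₁)))
    (SP5u : ∀ a : IdxB8SubDPer θ P, ∀ α₀ α₁ : ℝ, 0 < α₀ → 0 < α₁ → α₀ + α₁ ≤ cP →
      ∀ U₀ U' : Site θ.D → Fin θ.D → θ.𝔸ˣ, (∀ x κ, U₀ x κ ∈ unitaryUnits θ.𝔸) → (∀ x κ, U' x κ ∈ unitaryUnits θ.𝔸) →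
      IsPeriodic P U₀ → IsPeriodic P U' → ∀ φ : Φ, Adm a φ U₀ α₀ α₁ →
      InAk θ.L a.toZdIdx.k a.toZdIdx.η α₀ a.toZdIdx.Ω U₀ → InAk θ.L a.toZdIdx.k a.toZdIdx.η α₀ a.toZdIdx.Ω (mulCfg U' U₀) → (∀ m, m ≤ a.toZdIdx.k → InAx θ.L m (a.toZdIdx.Λs m) U₀ (mulCfg U' U₀)) →
      (∀ j, j ≤ a.toZdIdx.k → ∀ (z : Site θ.D) (μ : Fin θ.D),
        ((∀ x, InBox (tlo θ.L z j) (thi θ.L z j) x → x ∈ a.toZdIdx.Ω j) ∨ (∀ x, InBox (tlo θ.L (z + e μ) j) (thi θ.L (z + e μ) j) x → x ∈ a.toZdIdx.Ω j)) →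
        ‖(avgIter θ.L (mulCfg U' U₀) j z μ : θ.𝔸) - (avgIter θ.L U₀ j z μ : θ.𝔸)‖ ≤ α₁) →
      (∀ b ∈ {b : Site θ.D × Fin θ.D | SideTouches (a.toZdIdx.Ω 0) b.1 b.2}, ‖((U' b.1 b.2 : θ.𝔸ˣ) : θ.𝔸) - 1‖ ≤ α₁) →
      ∀ u₁ : Site θ.D → θ.𝔸ˣ, (∀ x, u₁ x ∈ unitaryUnits θ.𝔸) → (∀ x, x ∉ a.toZdIdx.Ω 0 → u₁ x = 1) → IsPeriodic P u₁ → Restr129 θ.L a.toZdIdx.k (a.toZdIdx.Λs a.toZdIdx.k) U₀ u₁ →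
      LanF a U₀ φ a.toZdIdx.k (mgauge U₀ u₁⁻¹ U') →
      (∃ A₁ : Site θ.D → Fin θ.D → θ.𝔸, ∀ j, j ≤ a.toZdIdx.k → ∀ (x : Site θ.D) (κ : Fin θ.D), SideTouches (a.toZdIdx.Ω j) x κ →
        mgauge U₀ u₁⁻¹ U' x κ = cfgExp a.toZdIdx.η A₁ x κ ∧ ‖A₁ x κ‖ ≤ (5 * (θ.D : ℝ) * θ.L * B₈ * (α₀ + α₁)) * ((θ.L : ℝ) ^ j * a.toZdIdx.η)⁻¹) →
      ∀ (v w : Site θ.D → θ.𝔸ˣ) (lam mu : Site θ.D → θ.𝔸),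
      IsPeriodic P v → IsPeriodic P w → IsPeriodic P lam → IsPeriodic P mu →
      (∀ x, ((gaugeExp lam x : θ.𝔸ˣ) : θ.𝔸) = ((v x : θ.𝔸ˣ) : θ.𝔸) ∧ IsSelfAdjoint (lam x) ∧ ‖lam x‖ < cu) → (∀ x, x ∉ a.toZdIdx.Ω 0 → lam x = 0) →
      (∀ j, j ≤ a.toZdIdx.k → ∀ b ∈ {b : Site θ.D × Fin θ.D | SideTouches (a.toZdIdx.Ω j) b.1 b.2}, ((θ.L : ℝ) ^ j * a.toZdIdx.η) * ‖covDerivFwd a.toZdIdx.η U₀ b.2 lam b.1‖ < cu) →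
      (∀ x, ((gaugeExp mu x : θ.𝔸ˣ) : θ.𝔸) = ((w x : θ.𝔸ˣ) : θ.𝔸) ∧ IsSelfAdjoint (mu x) ∧ ‖mu x‖ < cu) → (∀ x, x ∉ a.toZdIdx.Ω 0 → mu x = 0) →
      (∀ j, j ≤ a.toZdIdx.k → ∀ b ∈ {b : Site θ.D × Fin θ.D | SideTouches (a.toZdIdx.Ω j) b.1 b.2}, ((θ.L : ℝ) ^ j * a.toZdIdx.η) * ‖covDerivFwd a.toZdIdx.η U₀ b.2 mu b.1‖ < cu) →
      LanF a U₀ φ a.toZdIdx.k (mgauge U₀ v⁻¹ (mgauge U₀ u₁⁻¹ U')) → Restr129 θ.L a.toZdIdx.k (a.toZdIdx.Λs a.toZdIdx.k) U₀ (u₁ * v) →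
      LanF a U₀ φ a.toZdIdx.k (mgauge U₀ w⁻¹ (mgauge U₀ u₁⁻¹ U')) → Restr129 θ.L a.toZdIdx.k (a.toZdIdx.Λs a.toZdIdx.k) U₀ (u₁ * w) →
      ∀ x, v x = w x)
    (φ₀ : Φ) (hAdm₀ : ∀ a : IdxB8SubDPer θ P, ∀ α₀ α₁ : ℝ, 0 < α₀ → 0 < α₁ → ∀ U₀ : Site θ.D → Fin θ.D → θ.𝔸ˣ, (∀ x κ, U₀ x κ ∈ unitaryUnits θ.𝔸) →
      Adm a φ₀ U₀ α₀ α₁)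
    (hLan₀ : ∀ a : IdxB8SubDPer θ P, ∀ U₀ W : Site θ.D → Fin θ.D → θ.𝔸ˣ,
      LanF a U₀ φ₀ a.toZdIdx.k W ↔ IsLandau138W θ.L a.toZdIdx.k a.toZdIdx.η (a.toZdIdx.Ω 0) (a.toZdIdx.Λs a.toZdIdx.k) U₀ W)
    (hP3 : B8.Prop3Printed θ.D (θ.L : ℝ) lamPer.base.C₂ lamPer.base.inp lamPer.base.B₀β
      (fun j : IdxB8SubDPer θ P => (famB8OfRecordSubBP₂DPer θ lamPer.base.β lamPer.base.len P j).toGFData2))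
    (p5e : B8.Prop5Exists lamPer.base.inp.B₀' lamPer.base.B₁ lamPer.base.lan) (p5u : B8.Prop5Unique lamPer.base.lan)
    (p6 : B8.Prop6Printed θ.D (θ.L : ℝ) lamPer.base.B₁ lamPer.base.c₁ lamPer.base.cub)
    (p7Per : B8SectGH.Prop7PrintedR (famB8OfRecordSubBP₂DPer θ lamPer.base.β lamPer.base.len P) lamPer.toAxial)
    (t8Per : B8Thm8Surviving.Thm8SurvivingAt 1 lamPer.base.B₁ lamPer.base.B₂ (famB8OfRecordSubBP₂DPer θ lamPer.base.β lamPer.base.len P)) :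
    B8LeafOfRecordSubBP₂DPerκ θ P M₁ R lamPer :=
  b8LeafOfRecordSubBP₂DPerκ_of_subBP₂DPer lamPer (b8LeafOfRecordSubBP₂DPer_of_guarded lamPer hD hcu hcP hγ' hB₈ hB₀8 hB hγB hC₂ hB₀β hB₁'eq Adm LanF
    SP5base SP5 SH59src SP5u φ₀ hAdm₀ hLan₀ hP3 p5e p5u p6 p7Per t8Per)

#print axioms b8LeafOfRecordSubBP₂DPer_of_guarded
#print axioms b8LeafOfRecordSubBP₂DPerκ_of_guarded

end Summit.QuantumFields.YangMills.BalabanUVNodes.N05SubBP2DPerKappaSlotOfGuarded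

end
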